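import Literature.NumberTheory.LFunctions.WeilRescalingVariation
import Literature.NumberTheory.LFunctions.WeilBochnerExtension
import Literature.NumberTheory.LFunctions.WeilArchimedeanMoments
import Mathlib.Analysis.Calculus.Deriv.Shift
import HarnessLib

/-!
# RiemannHypothesis / GroundBarta — crux `PolarPerronFrobenius` (stmt-RiemannHypothesis-18390):
# the PRIME-TRUNCATION BARRIER, part 2b/3 — SPREAD, POLAR-FREE, EVEN tests at every large window

Helper file (`--supports`), RH-free, Mathlib + proved tree files only, no definitions.

For every window `a ≥ a₁` there is an even, real-valued, `L²`-normalised Weil test `w` supported in `[−a, a]`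
whose transform vanishes at BOTH poles, `ŵ(0) = ŵ(1) = 0` (so the polar term `2Re(ŵ(0) conj ŵ(1))` of every
finite-prime form `E_N` is zero), and which is spread at scale `a`: `‖w'‖₂² ≤ C/a²` with one absolute constant `C`
(`pt_exists_spread_polarFree_even_test`).  Construction: `w ∝ f'' − f/4` with `f(t) = β(t/a)` for a fixed smooth even
bump `β` (`(f'')^(s) = (s−1/2)² f̂(s)`, so `(f'' − f/4)^(s) = s(s−1) f̂(s)` vanishes at `s = 0, 1`; rescaling gives
`‖f^{(k)}‖₂² = a^{1−2k}‖β^{(k)}‖₂²`).  With part 2a these tests have `E_N(w) ≤ ψ(1/4) − 2Ψ_N − log π + K_N C/a²`,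
below the cone floor of part 1 for large `a` (part 3).
Prover B, speedrun unit `sr-gb-rung-b` (rung 3).

References: H. Yoshida, Adv. Stud. Pure Math. 21 (1992) §2; E. Bombieri, Rend. Lincei (9) 11 (2000) §4 (rescaling).
-/

set_option linter.dupNamespace false

noncomputable section

open Set MeasureTheory Filter Complex
open scoped Real Topology ComplexConjugate

namespace Summit.RiemannHypothesis.RiemannHypothesis.Theorems.PolarPerronFrobenius

open Literature.NumberTheory.LFunctions

variable {k f : ℝ → ℂ}

/-! ## Parity of derivatives -/

/-- The derivative of an even function is odd. [folklore] -/
theorem pt_deriv_odd_of_even (hf : ∀ t, f (-t) = f t) (t : ℝ) : deriv f (-t) = -deriv f t := by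
  have h : (fun x ↦ f (-x)) = f := funext hf
  have h1 : deriv f t = -deriv f (-t) := by
    rw [← deriv_comp_neg]; rw [h]
  rw [h1, neg_neg]

/-- The second derivative of an even function is even. [folklore] -/
theorem pt_deriv_deriv_even_of_even (hf : ∀ t, f (-t) = f t) (t : ℝ) :
    deriv (deriv f) (-t) = deriv (deriv f) t := by
  have hodd : (fun x ↦ -deriv f (-x)) = deriv f := funext fun x ↦ by rw [pt_deriv_odd_of_even hf x, neg_neg]
  have h1 : deriv (deriv f) t = deriv (fun x ↦ -deriv f (-x)) t := by rw [hodd]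
  rw [h1, deriv.fun_neg, deriv_comp_neg, neg_neg]

/-! ## Derivatives and norms of rescalings `t ↦ k(c t)` -/

/-- `(b k)' = b k'` for a Weil test `k` and a constant `b`. [folklore] -/
theorem pt_deriv_const_mul (hk : IsWeilTest k) (b : ℂ) :
    deriv (fun t ↦ b * k t) = fun t ↦ b * deriv k t := by
  funext t
  exact deriv_const_mul b (hk.1.differentiable (by simp) t)

/-- Second derivative of a rescaling: `(k(c·))'' t = c² k''(c t)`. [folklore] -/
theorem pt_deriv_deriv_comp_mul (hk : IsWeilTest k) (c : ℝ) :
    deriv (deriv fun t ↦ k (c * t)) = fun t ↦ (c : ℂ) ^ 2 * deriv (deriv k) (c * t) := by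
  rw [deriv_comp_mul_of_isWeilTest hk c]
  have h := deriv_comp_mul_of_isWeilTest (hk.deriv.const_mul (c : ℂ)) c
  rw [pt_deriv_const_mul hk.deriv] at h
  rw [show (fun t ↦ (c : ℂ) * deriv k (c * t)) = fun t ↦ (fun x ↦ (c : ℂ) * deriv k x) (c * t) from rfl, h]
  funext t
  ring

/-- Third derivative of a rescaling: `(k(c·))''' t = c³ k'''(c t)`. [folklore] -/
theorem pt_deriv3_comp_mul (hk : IsWeilTest k) (c : ℝ) :
    deriv (deriv (deriv fun t ↦ k (c * t))) = fun t ↦ (c : ℂ) ^ 3 * deriv (deriv (deriv k)) (c * t) := by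
  rw [pt_deriv_deriv_comp_mul hk c]
  have h := deriv_comp_mul_of_isWeilTest (hk.deriv.deriv.const_mul ((c : ℂ) ^ 2)) c
  rw [pt_deriv_const_mul hk.deriv.deriv] at h
  rw [show (fun t ↦ (c : ℂ) ^ 2 * deriv (deriv k) (c * t)) =
      fun t ↦ (fun x ↦ (c : ℂ) ^ 2 * deriv (deriv k) x) (c * t) from rfl, h]
  funext t
  ring

/-- `∫ ‖b · k(c t)‖² dt = ‖b‖² c⁻¹ ‖k‖₂²` for `c > 0`. [folklore] -/
theorem pt_weilNorm2Sq_const_mul_comp_mul (k : ℝ → ℂ) (b : ℂ) {c : ℝ} (hc : 0 < c) :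
    weilNorm2Sq (fun t ↦ b * k (c * t)) = ‖b‖ ^ 2 * c⁻¹ * weilNorm2Sq k := by
  unfold weilNorm2Sq
  simp only [norm_mul, mul_pow]
  rw [integral_const_mul, Measure.integral_comp_mul_left (fun y : ℝ ↦ ‖k y‖ ^ 2) c, smul_eq_mul,
    abs_of_pos (inv_pos.2 hc), mul_assoc]

/-- `‖·‖²` of a Weil test is integrable. [folklore] -/
theorem pt_integrable_norm_sq (hk : IsWeilTest k) : Integrable fun t ↦ ‖k t‖ ^ 2 := by
  have e : (fun t ↦ ‖k t‖ ^ 2) = fun t ↦ ‖k t‖ * ‖k t‖ := funext fun t ↦ sq _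
  rw [e]
  exact (hk.1.continuous.norm.mul hk.1.continuous.norm).integrable_of_hasCompactSupport
    hk.2.norm.mul_right


/-! ## The polar-free combination `f'' − f/4` -/

/-- `f'' − f/4` is a Weil test. [folklore] -/
theorem pt_isWeilTest_lap (hf : IsWeilTest f) :
    IsWeilTest fun t ↦ deriv (deriv f) t + (-(1 / 4) : ℂ) * f t :=
  hf.deriv.deriv.add (hf.const_mul _)

/-- **Both poles are killed**: `(f'' − f/4)^(0) = 0` (`(f'')^(s) = (s − 1/2)² f̂(s)`). [folklore] -/
theorem pt_weilMellin_lap_zero (hf : IsWeilTest f) :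
    weilMellin (fun t ↦ deriv (deriv f) t + (-(1 / 4) : ℂ) * f t) 0 = 0 := by
  have hc := hf.const_mul (-(1 / 4) : ℂ)
  rw [show (fun t ↦ deriv (deriv f) t + (-(1 / 4) : ℂ) * f t) =
      deriv (deriv f) + fun t ↦ (-(1 / 4) : ℂ) * f t from rfl,
    weilMellin_add hf.deriv.deriv.1.continuous hf.deriv.deriv.2 hc.1.continuous hc.2,
    weilMellin_deriv_deriv hf, weilMellin_const_mul]
  ring

/-- `(f'' − f/4)^(1) = 0`. [folklore] -/
theorem pt_weilMellin_lap_one (hf : IsWeilTest f) :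
    weilMellin (fun t ↦ deriv (deriv f) t + (-(1 / 4) : ℂ) * f t) 1 = 0 := by
  have hc := hf.const_mul (-(1 / 4) : ℂ)
  rw [show (fun t ↦ deriv (deriv f) t + (-(1 / 4) : ℂ) * f t) =
      deriv (deriv f) + fun t ↦ (-(1 / 4) : ℂ) * f t from rfl,
    weilMellin_add hf.deriv.deriv.1.continuous hf.deriv.deriv.2 hc.1.continuous hc.2,
    weilMellin_deriv_deriv hf, weilMellin_const_mul]
  ring

/-- `f'' − f/4` is even when `f` is. [folklore] -/
theorem pt_lap_even (hf : ∀ t, f (-t) = f t) (t : ℝ) :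
    deriv (deriv f) (-t) + (-(1 / 4) : ℂ) * f (-t) = deriv (deriv f) t + (-(1 / 4) : ℂ) * f t := by
  rw [pt_deriv_deriv_even_of_even hf, hf]

/-- `tsupport (f'' + b f) ⊆ tsupport f`. [folklore] -/
theorem pt_tsupport_lap_subset (f : ℝ → ℂ) (b : ℂ) :
    tsupport (fun t ↦ deriv (deriv f) t + b * f t) ⊆ tsupport f := by
  intro x hx
  by_contra hxf
  have h1 : f =ᶠ[𝓝 x] 0 := notMem_tsupport_iff_eventuallyEq.1 hxf
  have h2 : deriv f =ᶠ[𝓝 x] 0 := by simpa using h1.deriv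
  have h3 : deriv (deriv f) =ᶠ[𝓝 x] 0 := by simpa using h2.deriv
  have h4 : (fun t ↦ deriv (deriv f) t + b * f t) =ᶠ[𝓝 x] 0 := by
    filter_upwards [h1, h3] with t ht1 ht3
    simp only [Pi.zero_apply] at ht1 ht3 ⊢
    rw [ht1, ht3]; ring
  exact (notMem_tsupport_iff_eventuallyEq.2 h4) hx

/-- Derivative of `f'' − f/4`: the third derivative minus a quarter of the first. [folklore] -/
theorem pt_deriv_lap (hf : IsWeilTest f) :
    deriv (fun t ↦ deriv (deriv f) t + (-(1 / 4) : ℂ) * f t) =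
      fun t ↦ deriv (deriv (deriv f)) t + (-(1 / 4) : ℂ) * deriv f t := by
  funext t
  have h1 : DifferentiableAt ℝ (deriv (deriv f)) t := hf.deriv.deriv.1.differentiable (by simp) t
  have h2 : DifferentiableAt ℝ (fun t ↦ (-(1 / 4) : ℂ) * f t) t :=
    (hf.const_mul _).1.differentiable (by simp) t
  rw [deriv_fun_add h1 h2]
  congr 1
  exact congrFun (pt_deriv_const_mul hf _) t

/-! ## Norms of `f'' − f/4` for the rescaled profile `f = k(c ·)` -/

/-- Elementary: `‖p + (−1/4) q‖² ≥ ‖q‖²/32 − ‖p‖²`. [folklore] -/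
theorem pt_norm_sq_lap_ge (p q : ℂ) : ‖q‖ ^ 2 / 32 - ‖p‖ ^ 2 ≤ ‖p + (-(1 / 4) : ℂ) * q‖ ^ 2 := by
  have h1 : ‖(-(1 / 4) : ℂ) * q‖ ≤ ‖p + (-(1 / 4) : ℂ) * q‖ + ‖p‖ := by
    have := norm_sub_le (p + (-(1 / 4) : ℂ) * q) p
    rwa [add_sub_cancel_left] at this
  have h2 : ‖(-(1 / 4) : ℂ) * q‖ = ‖q‖ / 4 := by
    rw [norm_mul, norm_neg, norm_div, norm_one, Complex.norm_ofNat]; ring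
  rw [h2] at h1
  have h3 : ‖q‖ / 4 * (‖q‖ / 4) ≤ (‖p + (-(1 / 4) : ℂ) * q‖ + ‖p‖) * (‖p + (-(1 / 4) : ℂ) * q‖ + ‖p‖) :=
    mul_le_mul h1 h1 (by positivity) (by positivity)
  nlinarith [norm_nonneg (p + (-(1 / 4) : ℂ) * q), norm_nonneg p, norm_nonneg q,
    sq_nonneg (‖p + (-(1 / 4) : ℂ) * q‖ - ‖p‖), h3]

/-- Elementary: `‖p + (−1/4) q‖² ≤ 2‖p‖² + ‖q‖²/8`. [folklore] -/
theorem pt_norm_sq_lap_le (p q : ℂ) : ‖p + (-(1 / 4) : ℂ) * q‖ ^ 2 ≤ 2 * ‖p‖ ^ 2 + ‖q‖ ^ 2 / 8 := by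
  have h1 : ‖p + (-(1 / 4) : ℂ) * q‖ ≤ ‖p‖ + ‖(-(1 / 4) : ℂ) * q‖ := norm_add_le _ _
  have h2 : ‖(-(1 / 4) : ℂ) * q‖ = ‖q‖ / 4 := by
    rw [norm_mul, norm_neg, norm_div, norm_one, Complex.norm_ofNat]; ring
  rw [h2] at h1
  have h3 : ‖p + (-(1 / 4) : ℂ) * q‖ * ‖p + (-(1 / 4) : ℂ) * q‖ ≤ (‖p‖ + ‖q‖ / 4) * (‖p‖ + ‖q‖ / 4) :=
    mul_le_mul h1 h1 (norm_nonneg _) (by positivity)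
  nlinarith [norm_nonneg (p + (-(1 / 4) : ℂ) * q), norm_nonneg p, norm_nonneg q,
    sq_nonneg (‖p‖ - ‖q‖ / 4), h3]

/-- **Lower bound for `‖f'' − f/4‖₂²`**, `f = k(c·)`, `c > 0`:
`‖f'' − f/4‖₂² ≥ c⁻¹‖k‖₂²/32 − c³‖k''‖₂²`. [folklore] -/
theorem pt_weilNorm2Sq_lap_ge (hk : IsWeilTest k) {c : ℝ} (hc : 0 < c) :
    c⁻¹ * weilNorm2Sq k / 32 - c ^ 3 * weilNorm2Sq (deriv (deriv k)) ≤
      weilNorm2Sq fun t ↦ deriv (deriv fun x ↦ k (c * x)) t + (-(1 / 4) : ℂ) * k (c * t) := by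
  have hf : IsWeilTest fun x ↦ k (c * x) := hk.comp_mul hc.ne'
  have hg := pt_isWeilTest_lap hf
  rw [pt_deriv_deriv_comp_mul hk c] at hg ⊢
  have hn0 := pt_weilNorm2Sq_const_mul_comp_mul k 1 hc
  have hn2 := pt_weilNorm2Sq_const_mul_comp_mul (deriv (deriv k)) ((c : ℂ) ^ 2) hc
  simp only [one_mul, norm_one, one_pow] at hn0
  rw [norm_pow, Complex.norm_real, Real.norm_of_nonneg hc.le] at hn2
  have hi0 := pt_integrable_norm_sq (hk.comp_mul hc.ne')
  have hi2 := pt_integrable_norm_sq (hk.deriv.deriv.comp_mul hc.ne' |>.const_mul ((c : ℂ) ^ 2))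
  have hmono : ∫ t, (‖k (c * t)‖ ^ 2 / 32 - ‖(c : ℂ) ^ 2 * deriv (deriv k) (c * t)‖ ^ 2) ≤
      weilNorm2Sq fun t ↦ (c : ℂ) ^ 2 * deriv (deriv k) (c * t) + (-(1 / 4) : ℂ) * k (c * t) :=
    integral_mono ((hi0.div_const 32).sub hi2) (pt_integrable_norm_sq hg) fun t ↦ pt_norm_sq_lap_ge _ _
  rw [integral_sub (hi0.div_const 32) hi2, integral_div] at hmono
  unfold weilNorm2Sq at hn0 hn2 hmono ⊢
  rw [hn0, hn2] at hmono
  calc c⁻¹ * (∫ x, ‖k x‖ ^ 2) / 32 - c ^ 3 * ∫ x, ‖deriv (deriv k) x‖ ^ 2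
      = c⁻¹ * (∫ x, ‖k x‖ ^ 2) / 32 - (c ^ 2) ^ 2 * c⁻¹ * ∫ x, ‖deriv (deriv k) x‖ ^ 2 := by
        field_simp
    _ ≤ _ := hmono

/-- **Upper bound for the derivative**, `f = k(c·)`, `c > 0`:
`‖(f'' − f/4)'‖₂² ≤ 2c⁵‖k⁽³⁾‖₂² + c‖k'‖₂²/8`. [folklore] -/
theorem pt_weilNorm2Sq_deriv_lap_le (hk : IsWeilTest k) {c : ℝ} (hc : 0 < c) :
    weilNorm2Sq (deriv fun t ↦ deriv (deriv fun x ↦ k (c * x)) t + (-(1 / 4) : ℂ) * k (c * t)) ≤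
      2 * c ^ 5 * weilNorm2Sq (deriv (deriv (deriv k))) + c * weilNorm2Sq (deriv k) / 8 := by
  have hf : IsWeilTest fun x ↦ k (c * x) := hk.comp_mul hc.ne'
  rw [pt_deriv_lap hf, pt_deriv3_comp_mul hk c, deriv_comp_mul_of_isWeilTest hk c]
  have hn1 := pt_weilNorm2Sq_const_mul_comp_mul (deriv k) ((c : ℂ)) hc
  have hn3 := pt_weilNorm2Sq_const_mul_comp_mul (deriv (deriv (deriv k))) ((c : ℂ) ^ 3) hc
  rw [Complex.norm_real, Real.norm_of_nonneg hc.le] at hn1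
  rw [norm_pow, Complex.norm_real, Real.norm_of_nonneg hc.le] at hn3
  have hi1 := pt_integrable_norm_sq (hk.deriv.comp_mul hc.ne' |>.const_mul (c : ℂ))
  have hi3 := pt_integrable_norm_sq (hk.deriv.deriv.deriv.comp_mul hc.ne' |>.const_mul ((c : ℂ) ^ 3))
  have hsum : IsWeilTest fun t ↦ (c : ℂ) ^ 3 * deriv (deriv (deriv k)) (c * t) +
      (-(1 / 4) : ℂ) * ((c : ℂ) * deriv k (c * t)) :=
    (hk.deriv.deriv.deriv.comp_mul hc.ne' |>.const_mul ((c : ℂ) ^ 3)).add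
      ((hk.deriv.comp_mul hc.ne' |>.const_mul (c : ℂ)).const_mul _)
  have hmono : weilNorm2Sq (fun t ↦ (c : ℂ) ^ 3 * deriv (deriv (deriv k)) (c * t) +
      (-(1 / 4) : ℂ) * ((c : ℂ) * deriv k (c * t))) ≤
      ∫ t, (2 * ‖(c : ℂ) ^ 3 * deriv (deriv (deriv k)) (c * t)‖ ^ 2 + ‖(c : ℂ) * deriv k (c * t)‖ ^ 2 / 8) :=
    integral_mono (pt_integrable_norm_sq hsum) ((hi3.const_mul 2).add (hi1.div_const 8))
      fun t ↦ pt_norm_sq_lap_le _ _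
  rw [integral_add (hi3.const_mul 2) (hi1.div_const 8), integral_const_mul, integral_div] at hmono
  unfold weilNorm2Sq at hn1 hn3 hmono ⊢
  rw [hn1, hn3] at hmono
  calc _ ≤ _ := hmono
    _ = 2 * c ^ 5 * (∫ x, ‖deriv (deriv (deriv k)) x‖ ^ 2) + c * (∫ x, ‖deriv k x‖ ^ 2) / 8 := by
        field_simp

/-! ## Normalisation bookkeeping -/

/-- `‖b g‖₂² = ‖b‖² ‖g‖₂²`. [folklore] -/
theorem pt_weilNorm2Sq_const_mul (b : ℂ) (g : ℝ → ℂ) :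
    weilNorm2Sq (fun t ↦ b * g t) = ‖b‖ ^ 2 * weilNorm2Sq g := by
  unfold weilNorm2Sq
  simp only [norm_mul, mul_pow]
  rw [integral_const_mul]

/-! ## The spread, polar-free, even tests -/

/-- **SPREAD POLAR-FREE EVEN TESTS AT EVERY LARGE WINDOW.** There are an absolute constant `C > 0` and a
height `a₁ ≥ 1` such that every window `a ≥ a₁` carries an even, real-valued, `L²`-normalised Weil test `w`
supported in `[−a, a]` with `ŵ(0) = ŵ(1) = 0` (no polar term in any `E_N`) and `‖w'‖₂² ≤ C/a²`
(`w ∝ f'' − f/4`, `f(t) = β(t/a)`, `β` a smooth even bump on `[−1/2, 1/2]`). [folklore] -/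
theorem pt_exists_spread_polarFree_even_test :
    ∃ C : ℝ, 0 < C ∧ ∃ a₁ : ℝ, 1 ≤ a₁ ∧ ∀ a : ℝ, a₁ ≤ a → ∃ w : ℝ → ℂ,
      IsWeilTest w ∧ tsupport w ⊆ Icc (-a) a ∧ (∀ t, w (-t) = w t) ∧ (∀ t, (w t).im = 0) ∧
      weilMellin w 0 = 0 ∧ weilMellin w 1 = 0 ∧ weilNorm2Sq w = 1 ∧
      weilNorm2Sq (deriv w) ≤ C / a ^ 2 := by
  -- the profile
  let β : ContDiffBump (0 : ℝ) := ⟨1 / 4, 1 / 2, by norm_num, by norm_num⟩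
  set k : ℝ → ℂ := fun t ↦ ((β t : ℝ) : ℂ) with hk_def
  have hk : IsWeilTest k := WeilBochner.isWeilTest_bump β
  have hk_even : ∀ t, k (-t) = k t := fun t ↦ by simp only [hk_def, β.neg]
  have hk_supp : tsupport k ⊆ Icc (-(1 / 2)) (1 / 2) := WeilBochner.tsupport_bump_subset β
  -- real derivatives
  have hβ : ContDiff ℝ ((⊤ : ℕ∞) : WithTop ℕ∞) (β : ℝ → ℝ) := β.contDiff
  have hdβ : Differentiable ℝ (deriv (β : ℝ → ℝ)) :=
    (contDiff_infty_iff_deriv.mp hβ).2.differentiable (by simp)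
  have hd1 : deriv k = fun t ↦ ((deriv (β : ℝ → ℝ) t : ℝ) : ℂ) := by
    funext t
    exact ((hβ.differentiable (by simp)).differentiableAt.hasDerivAt.ofReal_comp).deriv
  have hd2 : deriv (deriv k) = fun t ↦ ((deriv (deriv (β : ℝ → ℝ)) t : ℝ) : ℂ) := by
    rw [hd1]
    funext t
    exact ((hdβ t).hasDerivAt.ofReal_comp).deriv
  -- the four norms
  set n₀ := weilNorm2Sq k with hn₀
  set n₁ := weilNorm2Sq (deriv k) with hn₁
  set n₂ := weilNorm2Sq (deriv (deriv k)) with hn₂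
  set n₃ := weilNorm2Sq (deriv (deriv (deriv k))) with hn₃
  have hn₀pos : 0 < n₀ := by
    rw [hn₀]
    unfold weilNorm2Sq
    refine Continuous.integral_pos_of_hasCompactSupport_nonneg_nonzero (x := 0)
      (hk.1.continuous.norm.pow 2) ?_ (fun t ↦ by positivity) ?_
    · have e : (fun t ↦ ‖k t‖ ^ 2) = fun t ↦ ‖k t‖ * ‖k t‖ := funext fun t ↦ sq _
      rw [e]; exact hk.2.norm.mul_right
    · have : k 0 = 1 := by
        simp only [hk_def]
        rw [β.one_of_mem_closedBall (by simp [β.rIn_pos.le])]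
        simp
      rw [this]; simp
  have hn₁nn : 0 ≤ n₁ := weilNorm2Sq_nonneg _
  have hn₂nn : 0 ≤ n₂ := weilNorm2Sq_nonneg _
  have hn₃nn : 0 ≤ n₃ := weilNorm2Sq_nonneg _
  -- constants
  refine ⟨64 * (2 * n₃ + n₁ / 8 + 1) / n₀, by positivity, max 1 (64 * n₂ / n₀), le_max_left _ _,
    fun a ha ↦ ?_⟩
  have ha1 : 1 ≤ a := le_trans (le_max_left _ _) ha
  have ha2 : 64 * n₂ / n₀ ≤ a := le_trans (le_max_right _ _) ha
  have ha0 : 0 < a := by linarith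
  set c := a⁻¹ with hc_def
  have hc : 0 < c := inv_pos.2 ha0
  have hc1 : c ≤ 1 := inv_le_one_of_one_le₀ ha1
  have hca : c * a = 1 := inv_mul_cancel₀ ha0.ne'
  -- the rescaled profile and the polar-free combination
  set f : ℝ → ℂ := fun x ↦ k (c * x) with hf_def
  have hf : IsWeilTest f := hk.comp_mul hc.ne'
  have hf_even : ∀ t, f (-t) = f t := fun t ↦ by
    simp only [hf_def, mul_neg]; exact hk_even _
  have hf_supp : tsupport f ⊆ Icc (-a) a := by
    refine (tsupport_comp_mul_subset k hc hk_supp).trans (Icc_subset_Icc ?_ ?_)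
    · rw [neg_le_neg_iff, div_le_iff₀ hc]; nlinarith
    · rw [div_le_iff₀ hc]; nlinarith
  set g : ℝ → ℂ := fun t ↦ deriv (deriv f) t + (-(1 / 4) : ℂ) * f t with hg_def
  have hg : IsWeilTest g := pt_isWeilTest_lap hf
  have hg_supp : tsupport g ⊆ Icc (-a) a := (pt_tsupport_lap_subset f _).trans hf_supp
  have hg_even : ∀ t, g (-t) = g t := fun t ↦ pt_lap_even hf_even t
  have hg0 : weilMellin g 0 = 0 := pt_weilMellin_lap_zero hf
  have hg1 : weilMellin g 1 = 0 := pt_weilMellin_lap_one hf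
  have hg_real : ∀ t, (g t).im = 0 := by
    intro t
    have e2 : deriv (deriv f) = fun t ↦ (c : ℂ) ^ 2 * deriv (deriv k) (c * t) := by
      rw [hf_def]; exact pt_deriv_deriv_comp_mul hk c
    have e3 : g t = ((c ^ 2 * deriv (deriv (β : ℝ → ℝ)) (c * t) + -(1 / 4) * β (c * t) : ℝ) : ℂ) := by
      have e0 : g t = deriv (deriv f) t + (-(1 / 4) : ℂ) * f t := rfl
      rw [e0, e2, hd2]
      simp only [hf_def, hk_def]
      push_cast
      ring
    rw [e3, Complex.ofReal_im]
  -- norms of `g`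
  have hN_ge : c⁻¹ * n₀ / 32 - c ^ 3 * n₂ ≤ weilNorm2Sq g := pt_weilNorm2Sq_lap_ge hk hc
  have hD_le : weilNorm2Sq (deriv g) ≤ 2 * c ^ 5 * n₃ + c * n₁ / 8 := pt_weilNorm2Sq_deriv_lap_le hk hc
  have hc3 : c ^ 3 * n₂ ≤ c⁻¹ * n₀ / 64 := by
    -- `c⁴ n₂ ≤ c n₂ ≤ n₀/64` since `c ≤ 1` and `a ≥ 64 n₂/n₀`
    rw [hc_def, inv_inv]
    have h1 : a⁻¹ ^ 3 ≤ a⁻¹ := by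
      calc a⁻¹ ^ 3 = a⁻¹ * (a⁻¹ * a⁻¹) := by ring
        _ ≤ a⁻¹ * (1 * 1) := by
            refine mul_le_mul_of_nonneg_left (mul_le_mul hc1 hc1 hc.le zero_le_one) hc.le
        _ = a⁻¹ := by ring
    have h2 : a⁻¹ * n₂ ≤ a * n₀ / 64 := by
      rw [div_le_iff₀ hn₀pos] at ha2
      have : a⁻¹ * n₂ ≤ 1 * n₂ := mul_le_mul_of_nonneg_right hc1 hn₂nn
      nlinarith
    nlinarith [mul_le_mul_of_nonneg_right h1 hn₂nn]
  have hN_pos : c⁻¹ * n₀ / 64 ≤ weilNorm2Sq g := by linarith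
  have hm_pos : 0 < c⁻¹ * n₀ / 64 := by positivity
  have hNg : 0 < weilNorm2Sq g := lt_of_lt_of_le hm_pos hN_pos
  have hD_le' : weilNorm2Sq (deriv g) ≤ c * (2 * n₃ + n₁ / 8) := by
    have h5 : c ^ 5 ≤ c := by
      calc c ^ 5 = c * (c ^ 2 * c ^ 2) := by ring
        _ ≤ c * (1 * 1) := by
            refine mul_le_mul_of_nonneg_left ?_ hc.le
            exact mul_le_mul (pow_le_one₀ hc.le hc1) (pow_le_one₀ hc.le hc1) (by positivity) zero_le_one
        _ = c := by ring
    nlinarith [mul_le_mul_of_nonneg_right h5 hn₃nn]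
  -- normalise
  set N := weilNorm2Sq g with hN_def
  set r : ℝ := (Real.sqrt N)⁻¹ with hr_def
  have hr2 : ‖(r : ℂ)‖ ^ 2 = N⁻¹ := by
    rw [Complex.norm_real, Real.norm_eq_abs, sq_abs, hr_def, inv_pow, Real.sq_sqrt hNg.le]
  set w : ℝ → ℂ := fun t ↦ (r : ℂ) * g t with hw_def
  have hw : IsWeilTest w := hg.const_mul _
  refine ⟨w, hw, ?_, ?_, ?_, ?_, ?_, ?_, ?_⟩
  · exact (tsupport_mul_subset_right (f := fun _ ↦ (r : ℂ)) (g := g)).trans hg_supp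
  · intro t; simp only [hw_def, hg_even]
  · intro t; simp only [hw_def, Complex.mul_im, Complex.ofReal_re, Complex.ofReal_im, hg_real]; ring
  · rw [hw_def, weilMellin_const_mul, hg0, mul_zero]
  · rw [hw_def, weilMellin_const_mul, hg1, mul_zero]
  · rw [hw_def, pt_weilNorm2Sq_const_mul, hr2, ← hN_def, inv_mul_cancel₀ hNg.ne']
  · rw [hw_def, pt_deriv_const_mul hg, pt_weilNorm2Sq_const_mul, hr2]
    -- `N⁻¹ ‖g'‖² ≤ c(2n₃ + n₁/8) / (c⁻¹ n₀/64) = 64 c² (2n₃ + n₁/8)/n₀ ≤ C/a²`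
    have hc2 : c ^ 2 = 1 / a ^ 2 := by rw [hc_def, inv_pow, one_div]
    calc N⁻¹ * weilNorm2Sq (deriv g) ≤ (c⁻¹ * n₀ / 64)⁻¹ * (c * (2 * n₃ + n₁ / 8)) := by
          refine mul_le_mul ?_ hD_le' (weilNorm2Sq_nonneg _) (by positivity)
          exact (inv_le_inv₀ hNg hm_pos).2 hN_pos
      _ = 64 * (2 * n₃ + n₁ / 8) / n₀ * c ^ 2 := by field_simp
      _ ≤ 64 * (2 * n₃ + n₁ / 8 + 1) / n₀ * c ^ 2 := by
          refine mul_le_mul_of_nonneg_right ?_ (sq_nonneg c)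
          exact div_le_div_of_nonneg_right (by nlinarith) hn₀pos.le
      _ = 64 * (2 * n₃ + n₁ / 8 + 1) / n₀ / a ^ 2 := by rw [hc2]; ring

end Summit.RiemannHypothesis.RiemannHypothesis.Theorems.PolarPerronFrobenius
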